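import Summits.BirchSwinnertonDyer.Rank1Residual.Additive.CyclotomicTowerSignedLocalIntersection
import HarnessLib

/-!
# Transversality at the level of COHOMOLOGY CLASSES: a class of `H¹(K_n, E[p^∞])` lying in the Kummer
# condition cut out by `E⁻(K_{n,v})` and restricting, at `v`, to the Kummer class of `g ⊗ p⁻¹` for an
# η-odd bottom point `g` forces `g ∈ p·E(K_{0,v})` (cell `b2b-bsdres`, CLASS-CLOSURE lane, class O10 —
# x1b GEN 31, class lead; sequel of `CyclotomicTowerSignedLocalTransverse.lean` (p312958) and
# `CyclotomicTowerSignedLocalIntersection.lean`)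

HONEST FRAMING (cell `b2b-bsdres`, run/shared/lean/b2b/bsd-rank1-residual/, verbatim in every
file): the goal of the cell is to DELETE the COMBINATION-SHAPED residual classes of the
Birch–Swinnerton-Dyer formula for ALL analytic-rank `≤ 1` elliptic curves over `ℚ` — "full BSD
formula for every rank `≤ 1` curve in class `C`" assembled STRICTLY from published theorems — so
that the rank-`≤ 1` remainder becomes exactly the CONSTRUCTION-SHAPED classes, which are TYPED
(missing-input `Prop`s), NOT attempted. This is not "finishing BSD". CLASS-CLOSURE lane: prove
what is provable now; shrink each hard class to its core with data; no claim beyond stated classes;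
research routes on CONSTRUCTION-SHAPED X12 / O10; census / instrument output = EVIDENCE / conjecture
items, NEVER a Literature fact; `RESIDUAL-MAP.md` marks change only by signed lines. THIS FILE:
TOOL THEOREMS ONLY over cc-typer-6's vocabulary (`localKummerOverOfEmb` of
`Kobayashi2003/SignedSelmer.lean`, `towerSignedLocalPointsOfEmb`, `localFixedPointsOfEmb`) — no
definition, no named Literature fact, no Summits-side fact `def`, no `sorry`, axioms standard;
Kobayashi's Prop. 8.12 ii) (generation half) and Prop. 8.7 enter as HYPOTHESES (`hsum`, `htors`),
never asserted; nothing is booked; no label / mark / count / sub-cell moves; O10 stays OPEN /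
CONSTRUCTION-SHAPED; nothing about `BSD(W, p)` of any pair is claimed.

## What is proved

`localKummerOverOfEmb W p H ι A` (tree, [Kobayashi2003] Def. 1.1 / 2.1: "We regard
`E(K_{n,v}) ⊗ ℚ_p/ℤ_p` as a subgroup of `H¹(K_{n,v}, E[p^∞])` by the Kummer map") consists of the
classes `c ∈ H¹(H, E[p^∞])` represented by a crossed homomorphism whose values on the local subgroup
`H_E` are `τ ↦ τQ − Q` with `p^k Q ∈ A` — the Kummer cocycle of `p^kQ ⊗ p^{−k} ∈ A ⊗ ℚ_p/ℤ_p`.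

* `mem_localFixedPointsOfEmb_of_two_kummer_cocycles`: if the SAME class `c` has two such local
  descriptions, `τ ↦ τQ − Q` and `τ ↦ τQ₁ − Q₁`, then the two cocycles differ by the coboundary of a
  torsion point `m ∈ E[p^∞]` (`oneCocycleClass_eq_zero_iff`), so `Q − Q₁ − ι(m) ∈ E(K_{n,v})` and
  `p^a ι(m) = 0` for some `a`.
* **`exists_mem_zero_eq_nsmul_of_mem_localKummerOverOfEmb_neg_one`**: for `H = U n` (the layer-`n`
  subgroup of an antitone normal finite-index tower with `q = p`-power local layer indices), `g` an
  η-ODD bottom point (`g ∈ E(K_{0,v})`, `τ₀ • g = −g`), and a class `c ∈ H¹(U n, E[p^∞])` that lies in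
  the minus Kummer condition `localKummerOverOfEmb W p (U n) ι (E⁻(K_{n,v}))` AND restricts at `ι` to
  the Kummer class of `g ⊗ p^{−1}` (a representative with local values `τQ₁ − Q₁`,
  `p^{j+1} Q₁ = p^j g`): then `g = p • S` with `S ∈ E(K_{0,v})` — under `hsum` (Prop. 8.12 ii),
  generation half), `htors` (Prop. 8.7), `hidx`, `p` odd. Proof: by the first bullet
  `Q₁ = Q − ι(m) − D` with `D ∈ E(K_{n,v})`, so for `N = k + a + j + 1`,
  `p^{N−1} g = p^N Q₁ = p^{a+j+1}(p^k Q) + p^N(−D) ∈ E⁻(K_{n,v}) + p^N E(K_{n,v})`, and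
  `exists_mem_zero_eq_nsmul_of_pow_nsmul_eq_add'` (FILE 2 of this series) concludes.
* `not_mem_localKummerOverOfEmb_neg_one_of_kummer_generator`: contrapositive — for `g` NOT
  `p`-divisible in `E(K_{0,v})` (the η-odd generator), NO class restricting to the Kummer class of
  `g ⊗ p^{−1}` lies in the `E⁻(K_{n,v})`-condition, at any layer `n`: the CLASS-LEVEL form of "the
  η-odd Kummer line meets Kobayashi's minus condition trivially" (`u(p) = 0` of x1b GEN 30's
  `C3ETA-ANATOMY-x1b.md`, derived in x1b GEN 31's `C3ETA-TRANSVERSALITY-x1b.md`).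

References: [Kobayashi2003] Def. 1.1 / 2.1 (pp. 2, 5), §2 p. 4, Prop. 8.7 (p. 16), Prop. 8.12 ii)
(pp. 17–18), Lemma 8.17 (p. 19); [SerreGaloisCohomology1997] I.§2.2, I.§5.1, II.§1.1.
-/

noncomputable section

open scoped Classical

universe u

namespace Summit.BirchSwinnertonDyer.Rank1Residual.Additive

open Literature.NumberTheory.EllipticCurves Literature.NumberTheory.GaloisRepresentations
  Literature.NumberTheory.EllipticCurves.Kobayashi2003 ZpExtension

section ClassLevel

variable {K : Type u} [Field K] {E : Type u} [Field E] [Algebra K E]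
  (ι : AlgebraicClosure K →ₐ[K] AlgebraicClosure E) (W : WeierstrassCurve K) (p : ℕ)

/-- **Two Kummer descriptions of one class differ by a torsion point.** If `φ`, `ψ` are crossed
homomorphisms on `H` with the same class in `H¹(H, E[p^∞])`, with local values `τ ↦ τQ − Q` and
`τ ↦ τQ₁ − Q₁` on `H_E`, then `φ − ψ = ∂m` for some `m ∈ E[p^∞]` (`oneCocycleClass_eq_zero_iff`),
hence `Q − Q₁ − ι(m)` is fixed by `H_E` (`∈ E(L_w)`), and `p^a·ι(m) = 0` for some `a`.
Serre, *Galois Cohomology*, I.§2.2 / I.§5.1. [cite: SerreGaloisCohomology1997, I.§5.1] -/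
theorem mem_localFixedPointsOfEmb_of_two_kummer_cocycles (H : Subgroup (Field.absoluteGaloisGroup K))
    {φ ψ : contOneCocycles.{0, u} (discreteTopRep H (W.geomPrimaryTorsion p))}
    (hclass : oneCocycleClass (discreteTopRep H (W.geomPrimaryTorsion p)) φ =
      oneCocycleClass (discreteTopRep H (W.geomPrimaryTorsion p)) ψ)
    {Q Q₁ : localPoints W E}
    (hφ : ∀ τ : localSubgroupOfEmb H ι,
      pointsMapOfEmb W ι ((φ.1 (resGalSubgroupOfEmb H ι τ) : W.geomPrimaryTorsion p) : W.geomPoints) =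
        (τ : Field.absoluteGaloisGroup E) • Q - Q)
    (hψ : ∀ τ : localSubgroupOfEmb H ι,
      pointsMapOfEmb W ι ((ψ.1 (resGalSubgroupOfEmb H ι τ) : W.geomPrimaryTorsion p) : W.geomPoints) =
        (τ : Field.absoluteGaloisGroup E) • Q₁ - Q₁) :
    ∃ (t : localPoints W E) (a : ℕ), p ^ a • t = 0 ∧ Q - Q₁ - t ∈ localFixedPointsOfEmb ι W H := by
  have hdiff : oneCocycleClass _ (φ - ψ) = 0 := by
    rw [← oneCocycleClassₗ_apply, map_sub, oneCocycleClassₗ_apply, oneCocycleClassₗ_apply, hclass,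
      sub_self]
  obtain ⟨m, hm⟩ := (oneCocycleClass_eq_zero_iff _ _).mp hdiff
  obtain ⟨a, ha⟩ := AddCommGroup.mem_primaryComponent.mp m.2
  refine ⟨pointsMapOfEmb W ι ((m : W.geomPrimaryTorsion p) : W.geomPoints), a, ?_, ?_⟩
  · rw [← map_nsmul, ha, map_zero]
  · have hval : ∀ σ : H, φ.1 σ = ψ.1 σ + (σ • m - m) := by
      intro σ
      have h := hm σ
      rw [Submodule.coe_sub, ContinuousMap.sub_apply, sub_eq_iff_eq_add'] at h
      rw [h]
      rfl
    rw [mem_localFixedPointsOfEmb_iff]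
    intro τ hτ
    have h1 := hφ ⟨τ, hτ⟩
    rw [hval, AddMemClass.coe_add, AddSubgroupClass.coe_sub, Subgroup.smul_def,
      primaryComponent.coe_smul, resGalSubgroupOfEmb_apply_coe, map_add, map_sub, pointsMapOfEmb_smul,
      hψ ⟨τ, hτ⟩] at h1
    -- h1 : τ • Q₁ - Q₁ + (τ • t - t) = τ • Q - Q
    change τ • Q₁ - Q₁ + (τ • pointsMapOfEmb W ι ((m : W.geomPrimaryTorsion p) : W.geomPoints) -
      pointsMapOfEmb W ι ((m : W.geomPrimaryTorsion p) : W.geomPoints)) = τ • Q - Q at h1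
    set t := pointsMapOfEmb W ι ((m : W.geomPrimaryTorsion p) : W.geomPoints)
    rw [smul_sub, smul_sub]
    calc τ • Q - τ • Q₁ - τ • t
        = (τ • Q - Q) - (τ • Q₁ - Q₁ + (τ • t - t)) + (Q - Q₁ - t) := by abel
      _ = Q - Q₁ - t := by rw [h1, sub_self, zero_add]

variable (U : ℕ → Subgroup (Field.absoluteGaloisGroup K)) [hU : ∀ n, (U n).FiniteIndex]

/-- **CLASS-LEVEL TRANSVERSALITY.** Tower `U` antitone, normal, finite index, local layer indices
dividing powers of `p`; `hsum` = Prop. 8.12 ii) (generation half) at layer `n`; `htors` = Prop. 8.7 at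
layer `n`; `p` odd. Let `g ∈ E(K_{0,v})` be η-odd (`τ₀ • g = −g`). If a class
`c ∈ H¹(U n, E[p^∞])` lies in the Kummer condition cut out by `E⁻(K_{n,v})`
(`localKummerOverOfEmb … (towerSignedLocalPointsOfEmb U ι W (-1) n)`) AND is represented by a
crossed homomorphism with local values `τ ↦ τQ₁ − Q₁` where `p^{j+1} Q₁ = p^j g` (i.e. `c`
restricts at `ι` to the Kummer class of `g ⊗ p^{−1}`), then `g = p • S` for some `S ∈ E(K_{0,v})`.
[cite: Kobayashi2003, Def. 2.1 (p. 5), Prop. 8.12 ii) (pp. 17–18), Lemma 8.17 (p. 19), Prop. 8.7 (p. 16)] -/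
theorem exists_mem_zero_eq_nsmul_of_mem_localKummerOverOfEmb_neg_one (hUa : Antitone U)
    [hN : ∀ n, (U n).Normal] (n : ℕ)
    (hsum : localFixedPointsOfEmb ι W (U n) ≤
      towerSignedLocalPointsOfEmb U ι W 1 n ⊔ towerSignedLocalPointsOfEmb U ι W (-1) n)
    (hodd : Odd p) (htors : ∀ Q ∈ localFixedPointsOfEmb ι W (U n), p • Q = 0 → Q = 0)
    (hidx : ∀ m ≤ n, ∃ k : ℕ,
      ((localSubgroupOfEmb (U n) ι).subgroupOf (localSubgroupOfEmb (U m) ι)).index ∣ p ^ k)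
    {g : localPoints W E} (hg : g ∈ localFixedPointsOfEmb ι W (U 0))
    {τ₀ : Field.absoluteGaloisGroup E} (hτ₀ : τ₀ • g = -g)
    {c : W.subgroupH1 p (U n)}
    (hc : c ∈ localKummerOverOfEmb W p (U n) ι (towerSignedLocalPointsOfEmb U ι W (-1) n))
    (hcg : ∃ (ψ : contOneCocycles.{0, u} (discreteTopRep (U n) (W.geomPrimaryTorsion p)))
      (Q₁ : localPoints W E) (j : ℕ),
      oneCocycleClass (discreteTopRep (U n) (W.geomPrimaryTorsion p)) ψ = c ∧
        p ^ (j + 1) • Q₁ = p ^ j • g ∧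
        ∀ τ : localSubgroupOfEmb (U n) ι,
          pointsMapOfEmb W ι ((ψ.1 (resGalSubgroupOfEmb (U n) ι τ) : W.geomPrimaryTorsion p) :
            W.geomPoints) = (τ : Field.absoluteGaloisGroup E) • Q₁ - Q₁) :
    ∃ S ∈ localFixedPointsOfEmb ι W (U 0), g = p • S := by
  obtain ⟨φ, Q, k, hφc, hQk, hφ⟩ := hc
  obtain ⟨ψ, Q₁, j, hψc, hQ₁, hψ⟩ := hcg
  obtain ⟨t, a, hta, hD⟩ := mem_localFixedPointsOfEmb_of_two_kummer_cocycles ι W p (U n)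
    (hφc.trans hψc.symm) hφ hψ
  set D := Q - Q₁ - t with hDdef
  have hQ₁eq : Q₁ = Q - t - D := by rw [hDdef]; abel
  -- `p^(k+a+j) • g = p^(a+j+1) • (p^k • Q) + p^(k+a+j+1) • (-D)`
  have key : p ^ (k + a + j) • g =
      p ^ (a + j + 1) • (p ^ k • Q) + p ^ (k + a + j + 1) • (-D) := by
    have e1 : p ^ (k + a + j) • g = p ^ (k + a) • (p ^ (j + 1) • Q₁) := by
      rw [hQ₁, ← mul_nsmul', ← pow_add]
    have et : p ^ (k + a + (j + 1)) • t = 0 := by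
      rw [show k + a + (j + 1) = (k + (j + 1)) + a by ring, pow_add, mul_nsmul', hta, smul_zero]
    have eQ : p ^ (k + a + (j + 1)) • Q = p ^ (a + j + 1) • (p ^ k • Q) := by
      rw [← mul_nsmul', ← pow_add, show a + j + 1 + k = k + a + (j + 1) by ring]
    rw [e1, ← mul_nsmul', ← pow_add, hQ₁eq, smul_sub, smul_sub, et, sub_zero, eQ, smul_neg,
      show k + a + j + 1 = k + a + (j + 1) by ring, sub_eq_add_neg]
  exact exists_mem_zero_eq_nsmul_of_pow_nsmul_eq_add' U ι W hUa n hsum hodd htors hidx hg hτ₀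
    (k + a + j) ((towerSignedLocalPointsOfEmb U ι W (-1) n).nsmul_mem hQk _)
    ((localFixedPointsOfEmb ι W (U n)).neg_mem hD) key

/-- **Contrapositive (the η-odd Kummer line meets the minus condition TRIVIALLY, class level).** For
`g` η-odd and NOT `p`-divisible in `E(K_{0,v})`, no class of `H¹(U n, E[p^∞])` that restricts at
`ι` to the Kummer class of `g ⊗ p^{−1}` lies in `localKummerOverOfEmb … (E⁻(K_{n,v}))` — at any
layer `n` (hypotheses `hsum`, `htors`, `hidx`, `p` odd). [cite: Kobayashi2003, Def. 2.1 (p. 5), Prop. 8.12 ii) (pp. 17–18), Prop. 8.7 (p. 16)] -/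
theorem not_mem_localKummerOverOfEmb_neg_one_of_kummer_generator (hUa : Antitone U)
    [hN : ∀ n, (U n).Normal] (n : ℕ)
    (hsum : localFixedPointsOfEmb ι W (U n) ≤
      towerSignedLocalPointsOfEmb U ι W 1 n ⊔ towerSignedLocalPointsOfEmb U ι W (-1) n)
    (hodd : Odd p) (htors : ∀ Q ∈ localFixedPointsOfEmb ι W (U n), p • Q = 0 → Q = 0)
    (hidx : ∀ m ≤ n, ∃ k : ℕ,
      ((localSubgroupOfEmb (U n) ι).subgroupOf (localSubgroupOfEmb (U m) ι)).index ∣ p ^ k)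
    {g : localPoints W E} (hg : g ∈ localFixedPointsOfEmb ι W (U 0))
    {τ₀ : Field.absoluteGaloisGroup E} (hτ₀ : τ₀ • g = -g)
    (hndiv : ∀ S ∈ localFixedPointsOfEmb ι W (U 0), g ≠ p • S)
    {c : W.subgroupH1 p (U n)}
    (hcg : ∃ (ψ : contOneCocycles.{0, u} (discreteTopRep (U n) (W.geomPrimaryTorsion p)))
      (Q₁ : localPoints W E) (j : ℕ),
      oneCocycleClass (discreteTopRep (U n) (W.geomPrimaryTorsion p)) ψ = c ∧
        p ^ (j + 1) • Q₁ = p ^ j • g ∧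
        ∀ τ : localSubgroupOfEmb (U n) ι,
          pointsMapOfEmb W ι ((ψ.1 (resGalSubgroupOfEmb (U n) ι τ) : W.geomPrimaryTorsion p) :
            W.geomPoints) = (τ : Field.absoluteGaloisGroup E) • Q₁ - Q₁) :
    c ∉ localKummerOverOfEmb W p (U n) ι (towerSignedLocalPointsOfEmb U ι W (-1) n) := by
  intro hc
  obtain ⟨S, hS, hgS⟩ := exists_mem_zero_eq_nsmul_of_mem_localKummerOverOfEmb_neg_one ι W p U hUa n
    hsum hodd htors hidx hg hτ₀ hc hcg
  exact hndiv S hS hgS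

end ClassLevel

end Summit.BirchSwinnertonDyer.Rank1Residual.Additive

end
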